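import Summits.AtomisticToContinuum.HydrodynamicLimit.Theorems.CollisionIsometryCLTMacroClosureStubClausiusTotals
import HarnessLib

/-!
# Stub `stub_clausius` of the line `IdeatorTwoGen1Sketch` (crux `MacroClosure`, stmt-14870), part 5:
# the deterministic core on a band configuration, and measurability of the block functionals

Support file (`--supports stmt-AtomisticToContinuum-14870`) for the registered stub
`Barycentric.stub_clausius` (consumed by part 6, the registered sub-goal `stub_clausius_core`).

Fix `N`, a flow `Φ`, a time `s`, a continuous non-negative kernel `φ` of mass one bounded by
`Φb < (N+1)c₁`, the band `B = {w | ∀ x, c₁ ≤ ρ̄(w,x) ∧ ρ̄(w,x)σ³ ≤ 1}`, the homogeneous state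
`U_c = stateOf 1 u_c θ_c`, `Λ_c = Dη_σ(U_c)` and the tilt
`F(w) = γ'(N+1) 𝟙_B(w) ∫ₓ h_σ⁺(Ū(w,x) | U_c) dx` of `HomogeneousBlockMGF`. Assume `f_ex` is continuous on
the band packings `[c₁σ³, 1]`. Then for a measurable `G ⊆ good ∩ Φ_s⁻¹ B`:

* DETERMINISTIC CORE (`Clausius.core_pointwise`): for `w ∈ B` with pairwise distinct velocities every
  block carries two particles with distinct velocities, so `θ̄ > 0` everywhere, `x ↦ η_σ(Ū(w,x))` is
  continuous, and the Bregman telescope gives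
  `−e(w) − 1 ≤ ∫ₓ η_σ(Ū(w,x)) dx ≤ ∫ₓ h_σ⁺(Ū|U_c) dx + η_σ(U_c) + Λ_c((1, p(w), e(w)) − U_c)`;
* MEASURABILITY: the band `B` is closed; clamping the block density to `[c₁, σ⁻³]` makes
  `η_σ ∘ clamp` measurable (only the continuity of `f_ex` on `[c₁σ³,1]` is used) and equal to `η_σ` on
  band states, so the parametric integrals `w ↦ ∫ₓ g(clamp Ū(w,x)) dx` are measurable
  (`StronglyMeasurable.integral_prod_right'`); part 6 turns this into the in-mean statement.
-/

noncomputable section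

open MeasureTheory Filter Set Topology InformationTheory
open scoped ENNReal ContDiff

namespace Summit.AtomisticToContinuum.HydrodynamicLimit.Theorems.MacroClosureLine

open Literature.MathematicalPhysics.KineticTheory Literature.Analysis.FluidPDE
open Literature.Analysis.FunctionSpaces

namespace Barycentric

namespace Clausius

variable {N : ℕ}

/-! ## Two particles per block on the band -/

/-- On the band, if the kernel is bounded by `Φb < (N+1) c₁`, every block carries two distinct
particles with positive weight. [folklore] -/
theorem exists_two_weights {φ : T3 → ℝ} (hφ0 : ∀ y, 0 ≤ φ y) {Φb c₁ : ℝ} (hφb : ∀ y, φ y ≤ Φb)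
    (hN : Φb < ((N + 1 : ℕ) : ℝ) * c₁) (w : Config (N + 1) (Fin 3) T3) (x : T3) (hx : c₁ ≤ bρ φ w x) :
    ∃ a b : Fin (N + 1), a ≠ b ∧ 0 < φ ((w a).1 - x) ∧ 0 < φ ((w b).1 - x) := by
  by_contra hcon
  push Not at hcon
  have hN0 : (0 : ℝ) < ((N + 1 : ℕ) : ℝ) := by positivity
  have hsum : ((N + 1 : ℕ) : ℝ) * bρ φ w x = ∑ i, φ ((w i).1 - x) := (block_sums φ w x).1
  have hle : ∑ i, φ ((w i).1 - x) ≤ Φb := by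
    by_cases hex : ∃ a, 0 < φ ((w a).1 - x)
    · obtain ⟨a, ha⟩ := hex
      have hothers : ∀ b, b ≠ a → φ ((w b).1 - x) = 0 := fun b hb =>
        le_antisymm (by simpa using hcon a b hb.symm ha) (hφ0 _)
      rw [Finset.sum_eq_single a (fun b _ hb => hothers b hb) (fun h => (h (Finset.mem_univ a)).elim)]
      exact hφb _
    · push Not at hex
      calc ∑ i, φ ((w i).1 - x) = ∑ i : Fin (N + 1), (0 : ℝ) :=
            Finset.sum_congr rfl fun i _ => le_antisymm (by simpa using hex i) (hφ0 _)
        _ = 0 := Finset.sum_const_zero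
        _ ≤ Φb := (hφ0 0).trans (hφb 0)
  have : ((N + 1 : ℕ) : ℝ) * c₁ ≤ ((N + 1 : ℕ) : ℝ) * bρ φ w x := mul_le_mul_of_nonneg_left hx hN0.le
  linarith

/-! ## Continuity of the block entropy on the band -/

/-- The block temperature is continuous in the block centre on the band. [folklore] -/
theorem continuous_stateTemp_bU {φ : T3 → ℝ} (hφc : Continuous φ) (w : Config (N + 1) (Fin 3) T3)
    (hρ0 : ∀ x, bρ φ w x ≠ 0) : Continuous fun x => stateTemp (bU φ w x) := by
  have hρ := continuous_bρ hφc w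
  have hm := continuous_bm hφc w
  have hE := continuous_bE hφc w
  simp_rw [stateTemp_bU]
  refine ((((continuous_const.mul hρ).mul hE).sub (hm.norm.pow 2)).div (continuous_const.mul (hρ.pow 2))
    fun x => ?_)
  exact mul_ne_zero three_ne_zero (pow_ne_zero 2 (hρ0 x))

/-- **Continuity of the block entropy functional on the band**: if `c₁ ≤ ρ̄ ≤ σ⁻³` everywhere,
`θ̄ > 0` everywhere and `f_ex` is continuous on `[c₁σ³, 1]`, then `x ↦ η_σ(Ū(w,x))` is continuous.
[folklore] -/
theorem continuous_hsEntropy_bU {σ c₁ : ℝ} (hσ : 0 < σ) (hc₁ : 0 < c₁)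
    (hfex : ContinuousOn hsExcessFreeEnergy (Icc (c₁ * σ ^ 3) 1)) {φ : T3 → ℝ} (hφc : Continuous φ)
    (w : Config (N + 1) (Fin 3) T3) (hband : ∀ x, c₁ ≤ bρ φ w x ∧ bρ φ w x * σ ^ 3 ≤ 1)
    (hθ : ∀ x, 0 < stateTemp (bU φ w x)) : Continuous fun x => hsEntropy σ (bU φ w x) := by
  have hρ := continuous_bρ hφc w
  have hρ0 : ∀ x, bρ φ w x ≠ 0 := fun x => (hc₁.trans_le (hband x).1).ne'
  have hT := continuous_stateTemp_bU hφc w hρ0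
  have hfe : Continuous fun x => hsExcessFreeEnergy (bρ φ w x * σ ^ 3) :=
    hfex.comp_continuous (hρ.mul continuous_const) fun x =>
      ⟨mul_le_mul_of_nonneg_right (hband x).1 (pow_nonneg hσ.le 3), (hband x).2⟩
  have hrepr : (fun x => hsEntropy σ (bU φ w x)) = fun x =>
      -(bρ φ w x * (3 / 2 * Real.log (stateTemp (bU φ w x)) - Real.log (bρ φ w x) -
        hsExcessFreeEnergy (bρ φ w x * σ ^ 3))) := rfl
  rw [hrepr]
  exact (hρ.mul ((((hT.log fun x => (hθ x).ne').const_mul _).sub (hρ.log hρ0)).sub hfe)).neg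

/-! ## Measurability of the block entropy functional through a density clamp -/

/-- The block state is jointly measurable in the configuration and the block centre (assembled from
measurable pieces; no Borel structure on the product space is needed). [folklore] -/
theorem measurable_bU_prod {φ : T3 → ℝ} (hφc : Continuous φ) :
    Measurable fun p : Config (N + 1) (Fin 3) T3 × T3 => bU φ p.1 p.2 := by
  have hφm : Measurable φ := hφc.measurable
  have hw : ∀ i : Fin (N + 1), Measurable fun p : Config (N + 1) (Fin 3) T3 × T3 => φ ((p.1 i).1 - p.2) :=
    fun i => hφm.comp ((((measurable_pi_apply i).comp measurable_fst).fst).sub measurable_snd)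
  have hv : ∀ i : Fin (N + 1), Measurable fun p : Config (N + 1) (Fin 3) T3 × T3 => (p.1 i).2 :=
    fun i => ((measurable_pi_apply i).comp measurable_fst).snd
  have hρ : Measurable fun p : Config (N + 1) (Fin 3) T3 × T3 => bρ φ p.1 p.2 := by
    simp only [bρ_eq_sum]
    exact measurable_const.mul (Finset.measurable_sum _ fun i _ => hw i)
  have hm : Measurable fun p : Config (N + 1) (Fin 3) T3 × T3 => bm φ p.1 p.2 := by
    have : (fun p : Config (N + 1) (Fin 3) T3 × T3 => bm φ p.1 p.2) =
        fun p => ((N + 1 : ℕ) : ℝ)⁻¹ • ∑ i, φ ((p.1 i).1 - p.2) • (p.1 i).2 := by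
      funext p
      have h := (block_sums φ p.1 p.2).2.1
      have hN : ((N + 1 : ℕ) : ℝ) ≠ 0 := by positivity
      rw [← h, smul_smul, inv_mul_cancel₀ hN, one_smul]
    rw [this]
    exact (Finset.measurable_sum _ fun i _ => (hw i).smul (hv i)).const_smul (((N + 1 : ℕ) : ℝ)⁻¹)
  have hE : Measurable fun p : Config (N + 1) (Fin 3) T3 × T3 => bE φ p.1 p.2 := by
    simp only [bE_eq_sum]
    exact measurable_const.mul (Finset.measurable_sum _ fun i _ => (hw i).mul (((hv i).norm.pow_const 2).div_const 2))
  exact hρ.prodMk (hm.prodMk hE)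

/-- The block state with its density clamped to `[c₁, σ⁻³]` is jointly measurable. [folklore] -/
theorem measurable_clampU {σ c₁ : ℝ} {φ : T3 → ℝ} (hφc : Continuous φ) :
    Measurable fun p : Config (N + 1) (Fin 3) T3 × T3 =>
      ((max c₁ (min (bρ φ p.1 p.2) (σ ^ 3)⁻¹), bm φ p.1 p.2, bE φ p.1 p.2) : State) := by
  have h := measurable_bU_prod (N := N) hφc
  have hρ : Measurable fun p : Config (N + 1) (Fin 3) T3 × T3 => bρ φ p.1 p.2 := h.fst
  have hm : Measurable fun p : Config (N + 1) (Fin 3) T3 × T3 => bm φ p.1 p.2 := h.snd.fst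
  have hE : Measurable fun p : Config (N + 1) (Fin 3) T3 × T3 => bE φ p.1 p.2 := h.snd.snd
  exact (measurable_const.max (hρ.min measurable_const)).prodMk (hm.prodMk hE)

/-- The hard-sphere entropy is measurable on states whose density lies in `[c₁, σ⁻³]`, in the form:
`U ↦ η_σ(clamp U)` is measurable (`f_ex` continuous on `[c₁σ³, 1]`). [folklore] -/
theorem measurable_hsEntropy_clamp {σ c₁ : ℝ} (hσ : 0 < σ) (hc₁σ : c₁ * σ ^ 3 ≤ 1)
    (hfex : ContinuousOn hsExcessFreeEnergy (Icc (c₁ * σ ^ 3) 1)) :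
    Measurable fun U : State => hsEntropy σ ((max c₁ (min U.1 (σ ^ 3)⁻¹), U.2) : State) := by
  have hσ3 : 0 < σ ^ 3 := pow_pos hσ 3
  have hr : Continuous fun U : State => max c₁ (min U.1 (σ ^ 3)⁻¹) := by fun_prop
  have hrmem : ∀ U : State, max c₁ (min U.1 (σ ^ 3)⁻¹) * σ ^ 3 ∈ Icc (c₁ * σ ^ 3) 1 := by
    intro U
    refine ⟨mul_le_mul_of_nonneg_right (le_max_left _ _) hσ3.le, ?_⟩
    have hc' : c₁ ≤ (σ ^ 3)⁻¹ := by rw [← one_div, le_div_iff₀ hσ3]; exact hc₁σ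
    have h1 : max c₁ (min U.1 (σ ^ 3)⁻¹) ≤ (σ ^ 3)⁻¹ := max_le hc' (min_le_right _ _)
    calc max c₁ (min U.1 (σ ^ 3)⁻¹) * σ ^ 3 ≤ (σ ^ 3)⁻¹ * σ ^ 3 :=
          mul_le_mul_of_nonneg_right h1 hσ3.le
      _ = 1 := inv_mul_cancel₀ hσ3.ne'
  have hfe : Continuous fun U : State => hsExcessFreeEnergy (max c₁ (min U.1 (σ ^ 3)⁻¹) * σ ^ 3) :=
    hfex.comp_continuous (hr.mul continuous_const) hrmem
  have hm1 : Measurable fun U : State => (U.2.1 : V3) := measurable_snd.fst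
  have hm2 : Measurable fun U : State => (U.2.2 : ℝ) := measurable_snd.snd
  have hrm : Measurable fun U : State => max c₁ (min U.1 (σ ^ 3)⁻¹) := hr.measurable
  show Measurable fun U : State =>
    -(max c₁ (min U.1 (σ ^ 3)⁻¹) * (3 / 2 * Real.log (2 / 3 * (U.2.2 / max c₁ (min U.1 (σ ^ 3)⁻¹) -
      ‖U.2.1‖ ^ 2 / (2 * max c₁ (min U.1 (σ ^ 3)⁻¹) ^ 2))) - Real.log (max c₁ (min U.1 (σ ^ 3)⁻¹)) -
      hsExcessFreeEnergy (max c₁ (min U.1 (σ ^ 3)⁻¹) * σ ^ 3)))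
  refine (hrm.mul (((Real.measurable_log.comp ?_).const_mul _ |>.sub (Real.measurable_log.comp hrm)).sub
    hfe.measurable)).neg
  exact ((hm2.div hrm).sub ((hm1.norm.pow_const 2).div (measurable_const.mul (hrm.pow_const 2)))).const_mul _

/-- On band states the clamp is invisible. [folklore] -/
theorem clamp_eq_of_band {σ c₁ : ℝ} (hσ : 0 < σ) {U : State} (h1 : c₁ ≤ U.1) (h2 : U.1 * σ ^ 3 ≤ 1) :
    ((max c₁ (min U.1 (σ ^ 3)⁻¹), U.2) : State) = U := by
  have hσ3 : 0 < σ ^ 3 := pow_pos hσ 3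
  have hU : U.1 ≤ (σ ^ 3)⁻¹ := by rw [← one_div, le_div_iff₀ hσ3]; exact h2
  rw [min_eq_left hU, max_eq_right h1]

/-- The band `{w | ∀ x, c₁ ≤ ρ̄(w,x) ∧ ρ̄(w,x)σ³ ≤ 1}` is a closed, hence measurable, set of
configurations. [folklore] -/
theorem measurableSet_band {σ c₁ : ℝ} {φ : T3 → ℝ} (hφc : Continuous φ) :
    MeasurableSet {w : Config (N + 1) (Fin 3) T3 | ∀ x, c₁ ≤ bρ φ w x ∧ bρ φ w x * σ ^ 3 ≤ 1} := by
  have hρ : ∀ x : T3, Continuous fun w : Config (N + 1) (Fin 3) T3 => bρ φ w x := fun x => by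
    simp only [bρ_eq_sum]; fun_prop
  have hclosed : IsClosed {w : Config (N + 1) (Fin 3) T3 | ∀ x, c₁ ≤ bρ φ w x ∧ bρ φ w x * σ ^ 3 ≤ 1} := by
    rw [setOf_forall]
    refine isClosed_iInter fun x => ?_
    rw [setOf_and]
    exact (isClosed_le continuous_const (hρ x)).inter (isClosed_le ((hρ x).mul continuous_const) continuous_const)
  exact hclosed.measurableSet

/-- **Measurability of clamped block functionals**: for a measurable `g : State → ℝ`, the parametric
integral `w ↦ ∫ₓ g(clamp Ū(w,x)) dx` is measurable. [folklore] -/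
theorem measurable_integral_clamp {σ c₁ : ℝ} {φ : T3 → ℝ} (hφc : Continuous φ) {g : State → ℝ}
    (hg : Measurable g) :
    Measurable fun w : Config (N + 1) (Fin 3) T3 =>
      ∫ x, g ((max c₁ (min (bρ φ w x) (σ ^ 3)⁻¹), bm φ w x, bE φ w x) : State) := by
  have hj : Measurable fun p : Config (N + 1) (Fin 3) T3 × T3 =>
      g ((max c₁ (min (bρ φ p.1 p.2) (σ ^ 3)⁻¹), bm φ p.1 p.2, bE φ p.1 p.2) : State) :=
    hg.comp (measurable_clampU hφc)
  exact (hj.stronglyMeasurable.integral_prod_right' (ν := volume)).measurable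

/-! ## The deterministic core: Bregman telescope on a band configuration -/

/-- **Deterministic core.** For a band configuration `w` with pairwise distinct velocities and a
kernel bounded by `Φb < (N+1)c₁`: `x ↦ η_σ(Ū(w,x))` is continuous,
`−e(w) − 1 ≤ ∫ₓ η_σ(Ū) dx`, and
`∫ₓ η_σ(Ū) dx ≤ ∫ₓ h_σ⁺(Ū | U_c) dx + η_σ(U_c) + Λ_c((1, p(w), e(w)) − U_c)` for every state `U_c`,
`Λ_c = Dη_σ(U_c)`. [folklore] -/
theorem core_pointwise {σ c₁ : ℝ} (hσ : 0 < σ) (hc₁ : 0 < c₁)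
    (hfex : ContinuousOn hsExcessFreeEnergy (Icc (c₁ * σ ^ 3) 1)) {φ : T3 → ℝ} (hφc : Continuous φ)
    (hφ0 : ∀ y, 0 ≤ φ y) (hφ1 : ∫ y, φ y = 1) {Φb : ℝ} (hφb : ∀ y, φ y ≤ Φb)
    (hN : Φb < ((N + 1 : ℕ) : ℝ) * c₁) (Uc : State) (w : Config (N + 1) (Fin 3) T3)
    (hband : ∀ x, c₁ ≤ bρ φ w x ∧ bρ φ w x * σ ^ 3 ≤ 1)
    (hvel : ∀ i j : Fin (N + 1), i ≠ j → (w i).2 ≠ (w j).2) :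
    Continuous (fun x => hsEntropy σ (bU φ w x)) ∧
    -(empiricalEnergyField w fun _ => (1 : ℝ)) - 1 ≤ ∫ x, hsEntropy σ (bU φ w x) ∧
    ∫ x, hsEntropy σ (bU φ w x) ≤ (∫ x, max 0 (relEnt σ (bU φ w x) Uc)) + hsEntropy σ Uc +
      fderiv ℝ (hsEntropy σ) Uc (((1 : ℝ), empiricalMomentumField w (fun _ => (1 : ℝ)),
        empiricalEnergyField w (fun _ => (1 : ℝ))) - Uc) := by
  -- positivity of the block temperature everywhere
  have hθ : ∀ x, 0 < stateTemp (bU φ w x) := by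
    intro x
    obtain ⟨a, b, hab, ha, hb⟩ := exists_two_weights hφ0 hφb hN w x (hband x).1
    exact stateTemp_bU_pos hφ0 w x ha hb (hvel a b hab)
  have hcont := continuous_hsEntropy_bU hσ hc₁ hfex hφc w hband hθ
  have hInt : Integrable fun x => hsEntropy σ (bU φ w x) := integrable_of_continuous_T3 hcont
  have hbU : Continuous fun x => bU φ w x :=
    (continuous_bρ hφc w).prodMk ((continuous_bm hφc w).prodMk (continuous_bE hφc w))
  have hbUint : Integrable fun x => bU φ w x := integrable_of_continuous_T3 hbU
  refine ⟨hcont, ?_, ?_⟩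
  · -- the floor
    have hneg : Integrable fun x => -bE φ w x := integrable_of_continuous_T3 (continuous_bE hφc w).neg
    have hfl : Integrable fun x => -bE φ w x - 1 := hneg.sub (integrable_const _)
    calc -(empiricalEnergyField w fun _ => (1 : ℝ)) - 1 = ∫ x, (-bE φ w x - 1) := by
          rw [integral_sub hneg (integrable_const _), integral_neg, integral_bE hφc hφ1, integral_const,
            smul_eq_mul, mul_one, probReal_univ]
      _ ≤ ∫ x, hsEntropy σ (bU φ w x) :=
          integral_mono hfl hInt fun x => neg_bE_sub_one_le_hsEntropy σ hφ0 w x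
  · -- the Bregman telescope
    set Λ : State →L[ℝ] ℝ := fderiv ℝ (hsEntropy σ) Uc with hΛ
    have hrel : Continuous fun x => relEnt σ (bU φ w x) Uc := by
      have : (fun x => relEnt σ (bU φ w x) Uc) =
          fun x => hsEntropy σ (bU φ w x) - hsEntropy σ Uc - Λ (bU φ w x - Uc) := rfl
      rw [this]
      exact (hcont.sub continuous_const).sub (Λ.continuous.comp (hbU.sub continuous_const))
    have hrelInt : Integrable fun x => relEnt σ (bU φ w x) Uc := integrable_of_continuous_T3 hrel
    have hplusInt : Integrable fun x => max 0 (relEnt σ (bU φ w x) Uc) :=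
      integrable_of_continuous_T3 (continuous_const.max hrel)
    have hΛint : Integrable fun x => Λ (bU φ w x - Uc) :=
      integrable_of_continuous_T3 (Λ.continuous.comp (hbU.sub continuous_const))
    have hdecomp : ∀ x, hsEntropy σ (bU φ w x) =
        relEnt σ (bU φ w x) Uc + hsEntropy σ Uc + Λ (bU φ w x - Uc) := by
      intro x
      show hsEntropy σ (bU φ w x) =
        hsEntropy σ (bU φ w x) - hsEntropy σ Uc - Λ (bU φ w x - Uc) + hsEntropy σ Uc + Λ (bU φ w x - Uc)
      ring
    have hsubint : Integrable fun x => bU φ w x - Uc := hbUint.sub (integrable_const Uc)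
    have hΛcomm : ∫ x, Λ (bU φ w x - Uc) = Λ ((∫ x, bU φ w x) - Uc) := by
      rw [ContinuousLinearMap.integral_comp_comm Λ hsubint, integral_sub hbUint (integrable_const Uc),
        integral_const, probReal_univ, one_smul]
    have h12 : Integrable fun x => relEnt σ (bU φ w x) Uc + hsEntropy σ Uc := hrelInt.add (integrable_const _)
    calc ∫ x, hsEntropy σ (bU φ w x)
        = ∫ x, (relEnt σ (bU φ w x) Uc + hsEntropy σ Uc + Λ (bU φ w x - Uc)) :=
          integral_congr_ae (Eventually.of_forall hdecomp)
      _ = (∫ x, relEnt σ (bU φ w x) Uc) + hsEntropy σ Uc + Λ ((∫ x, bU φ w x) - Uc) := by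
          rw [integral_add h12 hΛint, integral_add hrelInt (integrable_const _), integral_const, probReal_univ,
            one_smul, hΛcomm]
      _ ≤ (∫ x, max 0 (relEnt σ (bU φ w x) Uc)) + hsEntropy σ Uc + Λ ((∫ x, bU φ w x) - Uc) := by
          have := integral_mono hrelInt hplusInt fun x => le_max_right 0 (relEnt σ (bU φ w x) Uc)
          linarith
      _ = _ := by rw [integral_bU hφc hφ1]

end Clausius

/-- Registered sub-goal `stub_clausius_pointwise` of the stub `stub_clausius`: the deterministic core on
a band configuration (`Clausius.core_pointwise`). [folklore] -/
theorem stub_clausius_pointwise : ∀ (σ c₁ : ℝ), 0 < σ → 0 < c₁ → ContinuousOn hsExcessFreeEnergy (Icc (c₁ * σ ^ 3) 1) → ∀ (N : ℕ) (φ : T3 → ℝ), Continuous φ → (∀ y, 0 ≤ φ y) → ∫ y, φ y = 1 → ∀ Φb : ℝ, (∀ y, φ y ≤ Φb) → Φb < ((N + 1 : ℕ) : ℝ) * c₁ → ∀ (Uc : State) (w : Config (N + 1) (Fin 3) T3), (∀ x, c₁ ≤ bρ φ w x ∧ bρ φ w x * σ ^ 3 ≤ 1) → (∀ i j : Fin (N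 + 1), i ≠ j → (w i).2 ≠ (w j).2) → Continuous (fun x => hsEntropy σ (bU φ w x)) ∧ -(empiricalEnergyField w fun _ => (1 : ℝ)) - 1 ≤ ∫ x, hsEntropy σ (bU φ w x) ∧ ∫ x, hsEntropy σ (bU φ w x) ≤ (∫ x, max 0 (relEnt σ (bU φ w x) Uc)) + hsEntropy σ Uc + fderiv ℝ (hsEntropy σ) Uc (((1 : ℝ), empiricalMomentumField w (fun _ => (1 : ℝ)), empiricalEnergyField w (fun _ => (1 : ℝ))) - Uc) :=
  fun _ _ hσ hc₁ hfex _ _ hφc hφ0 hφ1 _ hφb hN Uc w hband hvel =>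
    Clausius.core_pointwise hσ hc₁ hfex hφc hφ0 hφ1 hφb hN Uc w hband hvel

end Barycentric

end Summit.AtomisticToContinuum.HydrodynamicLimit.Theorems.MacroClosureLine

end
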